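import Summits.BirchSwinnertonDyer.Rank1Residual.Additive.X4SharpThreeKimLattice
import Summits.BirchSwinnertonDyer.Rank1Residual.X4.OptimalPeriod
import HarnessLib

/-!
# §(η) lattice, the PERIOD-TRANSFER edge: `KimThreeShaLength ⟹ KimThree` holds exactly modulo `per`
# (team n1011, OWNERS row T-a2, referee 1's ONE open line of 2026-08-21T06:30Z / lead R5-2(h); seat p03;
# sibling of `X4SharpThreeKimLattice.lean` §1/§3)

HONEST FRAMING (cell `b2b-bsdres`, run/shared/lean/b2b/bsd-rank1-residual/, verbatim in every
file): the goal of the cell is to DELETE the COMBINATION-SHAPED residual classes of the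
Birch–Swinnerton-Dyer formula for ALL analytic-rank `≤ 1` elliptic curves over `ℚ` — "full BSD
formula for every rank `≤ 1` curve in class `C`" assembled STRICTLY from published theorems — so
that the rank-`≤ 1` remainder becomes exactly the CONSTRUCTION-SHAPED classes, which are TYPED
(missing-input `Prop`s), NOT attempted. This is not "finishing BSD". Research routes; no claim beyond
stated classes; census output = EVIDENCE / conjecture items, never a Literature fact; nothing below
is booked; the label X4 and the mark of RESIDUAL-MAP §I N11 are UNCHANGED by this file. NOTHING is
asserted and NO new `Prop` is introduced: every theorem below is an implication between `Prop`s
ALREADY in the tree, with the announced [K25] record only ever an explicit hypothesis.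

## What this file proves (referee 1, CS-1 T-a2, 06:30Z: "name the edge `KimThreeShaLength ⟹ KimThree`
## or record which binder differs")

The binder that differs is the PERIOD TRANSFER `per`:
`∃ u : ℚ, ‖u‖_p = 1 ∧ Ω(W) = u · Ω⁺_{D.f}`. It is a binder of cc-typer-1's `∂`-exact shape
`KimRankZeroShaLengthAt W p` (and of the unit / LOWER / UPPER-div shapes), and it is ABSENT from the
inequality shape of record `KimRankZeroBoundAt W p` (p03, `X4SharpThreeKimShape.lean`), which — byte-
faithful to the vendored `Kim2026.rankZero_padicValNat_sha_le_of_maninConstant` — quantifies over EVERY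
modular parametrisation datum `D` with `p ∤ c_D`, period transfer or not. Hence (§(η) η.8 (1) of
cells/n1011/KIM-AT-3-ANATOMY.md): `KimThreeShaLength ⟹ KimThree` is NOT a formal edge as typed, and
the exact repair is to supply `per`:

* §1 per pair: `KimRankZeroShaLengthAt W p` + `per` for every admissible datum ⟹ `KimRankZeroBoundAt W p`
  (`kimRankZeroBoundAt_of_kimRankZeroShaLengthAt_of_periodTransfer`); datum-wise, the `∂`-exact shape
  gives the inequality's CONCLUSION on every datum carrying `per` — in particular on every OPTIMAL
  datum with `p ∤ c_D`, where `per` is additive-p4's theorem `X4.periodTransfer_of_optimal`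
  (`sha_le_of_kimRankZeroShaLengthAt_of_optimal`). The residual gap `KimThreeShaLength ⇏ KimThree` is
  therefore exactly the NON-optimal data with `3 ∤ c_D` and no period transfer in hand.
* §2 class level at `3`: `KimThreeShaLength ∧ (per on all admissible data) ⟹ KimThree`,
  `X4SharpThreeKimShaLength ∧ (per on the additive rows) ⟹ X4SharpThreeKim`, and — composing with
  `kimThreeShaLength_of_kim2025_OPEN_of_integral` — the PRIMARY announced record
  `Kim2025.thm11_kimShaLength_of_integralPeriod_OPEN` ∧ int ∧ per ⟹ `KimThree` / `X4SharpThreeKim`.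
  So `KimThree`-of-record IS implied by [K25]-as-typed modulo the two named binders int (T-R18b,
  flag `Kim2025-OmegaE-integrality`) and per (this file); unconditionally-in-binders it is implied by
  the flagged Ω(W)/Manin second record (`kimThree_of_kim2025_OPEN`, `X4SharpThreeKimBridge.lean`).

References: C.-H. Kim, Amer. J. Math. 148 (2026) = arXiv:2203.12159v4, Thm. 1.9 (6), §1.3.5, §1.4.3,
§1.5.1 [Kim2022StructureSelmer]; C.-H. Kim (app. R. Pollack), arXiv:2505.09121v1 (2025, PREPRINT —
ANNOUNCED, flag `Kim2025-preprint`) Thm. 1.1, Cor. 1.7 [Kim2025RefinedTNC]; J. Cremona, *Algorithms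
for modular elliptic curves* (1997) §2.8 [CremonaAlgorithms1997]; cell files
cells/n1011/KIM-AT-3-ANATOMY.md §(η) η.8 (1) / η.12, cells/n1011/REFEREE-1.md (CS-1 T-a2 06:30Z),
cells/n1011/PLAN.md R5-2 (h).
-/

noncomputable section

open scoped Classical MatrixGroups ModularForm

open CongruenceSubgroup WeierstrassCurve Literature.NumberTheory.EllipticCurves
  Literature.NumberTheory.EllipticCurves.ModularForms
  Literature.NumberTheory.EllipticCurves.Rank1Residual
  Literature.NumberTheory.EllipticCurves.Rank1Residual.Typed

namespace Summit.BirchSwinnertonDyer.Rank1Residual.Additive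

open Summit.BirchSwinnertonDyer.Rank1Residual.X4

/-! ## §1 Per pair, analytic rank `0`: the `∂`-exact shape plus `per` gives the inequality shape -/

section PerPair

variable (W : WeierstrassCurve ℚ) [W.IsElliptic] [W.IsGloballyMinimal] (p : ℕ) [Fact p.Prime]

/-- **`KimRankZeroShaLengthAt W p` ∧ (`per` on every admissible datum) ⟹ `KimRankZeroBoundAt W p`**
(any `p`). The `∂`-exact shape concludes, under the period transfer, `ord_p(L(E,1)/Ω(W)) =
ord_p #Ш(E/ℚ)(p) + ∂^{(∞)}(δ̃)` with `∂^{(∞)} = d ∈ ℕ`, whence the inequality `ord_p #Ш(p) ≤ ord_p q`.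
The hypothesis `hper` — the period transfer for EVERY datum with `p ∤ c_D` — is exactly the binder
by which the two `Prop`s differ (§(η) η.8 (1)); without it the implication is not formal.
[cite: Kim2022StructureSelmer, Thm. 1.9 (6) (PDF p. 8), §1.4.3 and §1.5.1 (PDF p. 7)] -/
theorem kimRankZeroBoundAt_of_kimRankZeroShaLengthAt_of_periodTransfer
    (h : KimRankZeroShaLengthAt W p)
    (hper : ∀ {N : ℕ} [NeZero N] (D : ModularParametrizationData W N), ¬ (p : ℤ) ∣ D.maninConstant →
      ∃ u : ℚ, ‖(u : ℚ_[p])‖ = 1 ∧ W.realPeriodRat = u * plusPeriod D.f) :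
    KimRankZeroBoundAt W p := by
  intro hsurj htower hL hfin N _ D hc
  obtain ⟨q, d, hq, _, hval⟩ := h hsurj htower hL hfin D hc (hper D hc)
  refine ⟨q, hq, ?_⟩
  rw [hval]
  exact le_add_of_nonneg_right (Nat.cast_nonneg d)

/-- **Datum-wise (the honest partial edge): the `∂`-exact shape gives the INEQUALITY's conclusion on
every datum that carries the period transfer.** Under surj(p), the tower, `L(E,1) ≠ 0`, `Ш` finite,
for a datum `D` with `p ∤ c_D` AND `Ω(W) = u·Ω⁺_{D.f}`, `|u|_p = 1`: `L(E,1)/Ω(W) = q ∈ ℚ` with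
`ord_p #Ш(E/ℚ)(p) ≤ ord_p q`. [cite: Kim2022StructureSelmer, Thm. 1.9 (6) (PDF p. 8), §1.5.1 (PDF p. 7)] -/
theorem sha_le_of_kimRankZeroShaLengthAt_of_periodTransfer (h : KimRankZeroShaLengthAt W p)
    (hsurj : W.HasSurjectiveModNGaloisRep p) (htower : ∀ n : ℕ, W.HasSurjectiveModNGaloisRep (p ^ n : ℕ))
    (hL : W.entireLFunction 1 ≠ 0) (hfin : Finite W.sha)
    {N : ℕ} [NeZero N] (D : ModularParametrizationData W N) (hc : ¬ (p : ℤ) ∣ D.maninConstant)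
    (hper : ∃ u : ℚ, ‖(u : ℚ_[p])‖ = 1 ∧ W.realPeriodRat = u * plusPeriod D.f) :
    ∃ q : ℚ, W.entireLFunction 1 / (W.realPeriodRat : ℂ) = (q : ℂ) ∧
      (padicValNat p (Nat.card (AddCommGroup.primaryComponent W.sha p)) : ℤ) ≤ padicValRat p q := by
  obtain ⟨q, d, hq, _, hval⟩ := h hsurj htower hL hfin D hc hper
  refine ⟨q, hq, ?_⟩
  rw [hval]
  exact le_add_of_nonneg_right (Nat.cast_nonneg d)

/-- **On an OPTIMAL datum the period transfer is a theorem, so the `∂`-exact shape gives the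
inequality's conclusion outright**: `D` optimal (`Λ_E = c_D · Λ_{D.f}`, `hopt`) with `p ∤ c_D`
(`per` = additive-p4's `X4.periodTransfer_of_optimal`, `u = |c_D|`). The gap
`KimThreeShaLength ⇏ KimThree` is thus confined to the NON-optimal data with `p ∤ c_D`.
[cite: Kim2022StructureSelmer, Thm. 1.9 (6) (PDF p. 8), §1.3.5] [cite: CremonaAlgorithms1997, §2.8 (p. 26)] -/
theorem sha_le_of_kimRankZeroShaLengthAt_of_optimal (h : KimRankZeroShaLengthAt W p)
    (hsurj : W.HasSurjectiveModNGaloisRep p) (htower : ∀ n : ℕ, W.HasSurjectiveModNGaloisRep (p ^ n : ℕ))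
    (hL : W.entireLFunction 1 ≠ 0) (hfin : Finite W.sha)
    {N : ℕ} [NeZero N] (D : ModularParametrizationData W N)
    (hopt : ∀ z ∈ D.L.lattice, ∃ w ∈ periodLattice D.f, z = D.c * w)
    (hc : ¬ (p : ℤ) ∣ D.maninConstant) :
    ∃ q : ℚ, W.entireLFunction 1 / (W.realPeriodRat : ℂ) = (q : ℂ) ∧
      (padicValNat p (Nat.card (AddCommGroup.primaryComponent W.sha p)) : ℤ) ≤ padicValRat p q :=
  sha_le_of_kimRankZeroShaLengthAt_of_periodTransfer W p h hsurj htower hL hfin D hc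
    (periodTransfer_of_optimal p D hopt hc)

end PerPair

/-! ## §2 Class level at `p = 3`: `KimThreeShaLength ⟹ KimThree` modulo `per`, and the [K25] chain -/

section ClassLevel

/-- **`KimThreeShaLength` ∧ (`per` on every admissible datum of every curve) ⟹ `KimThree`** — the
edge referee 1 asked for, with its missing binder made explicit: the `∂`-exact every-curve conjecture
at `3` implies p03's inequality conjecture OF RECORD exactly modulo the period transfer.
[cite: Kim2022StructureSelmer, Thm. 1.9 (6) (PDF p. 8), §1.5.1 (PDF p. 7)] -/
theorem kimThree_of_kimThreeShaLength_of_periodTransfer (h : KimThreeShaLength)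
    (hper : ∀ (W : WeierstrassCurve ℚ) [W.IsElliptic] [W.IsGloballyMinimal]
      {N : ℕ} [NeZero N] (D : ModularParametrizationData W N), ¬ (3 : ℤ) ∣ D.maninConstant →
      ∃ u : ℚ, ‖(u : ℚ_[3])‖ = 1 ∧ W.realPeriodRat = u * plusPeriod D.f) :
    KimThree :=
  fun W _ _ => kimRankZeroBoundAt_of_kimRankZeroShaLengthAt_of_periodTransfer W 3 (h W)
    (fun D hc => hper W D hc)

/-- **`X4SharpThreeKimShaLength` ∧ (`per` on the admissible data of the ADDITIVE rows) ⟹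
`X4SharpThreeKim`** (the N11 hypothesis, inequality shape of record, from its `∂`-exact twin).
[cite: Kim2022StructureSelmer, Thm. 1.9 (6) (PDF p. 8), §1.5.1 (PDF p. 7)] -/
theorem x4SharpThreeKim_of_x4SharpThreeKimShaLength_of_periodTransfer (h : X4SharpThreeKimShaLength)
    (hper : ∀ (W : WeierstrassCurve ℚ) [W.IsElliptic] [W.IsGloballyMinimal], Addv W 3 →
      ∀ {N : ℕ} [NeZero N] (D : ModularParametrizationData W N), ¬ (3 : ℤ) ∣ D.maninConstant →
      ∃ u : ℚ, ‖(u : ℚ_[3])‖ = 1 ∧ W.realPeriodRat = u * plusPeriod D.f) :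
    X4SharpThreeKim :=
  fun W _ _ hA => kimRankZeroBoundAt_of_kimRankZeroShaLengthAt_of_periodTransfer W 3 (h W hA)
    (fun D hc => hper W hA D hc)

/-- **[K25] Thm. 1.1 own-currency PRIMARY `_OPEN` record ∧ int ∧ per ⟹ `KimThree`** — p03's
conjecture OF RECORD from the announced statement AS TYPED (T-a4's primary P1), modulo the two named
binders: `hint` = `Ω⁺_f`-integrality of the plus symbols of every admissible datum (team row T-R18b,
flag `Kim2025-OmegaE-integrality`) and `hper` = the period transfer (this file). Composition of
`kimThreeShaLength_of_kim2025_OPEN_of_integral` with `kimThree_of_kimThreeShaLength_of_periodTransfer`.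
CONDITIONAL on the preprint (`hK25s`, ANNOUNCED, never a theorem of the tree; flag `Kim2025-preprint`).
[claim: Kim2025RefinedTNC, status: under-review]
[cite: Kim2025RefinedTNC, Thm. 1.1 ("BSD"), Cor. 1.7 (ANNOUNCED preprint — the reason, not a source of truth)]
[cite: Kim2022StructureSelmer, §1.4.1 and §1.3.5 (PDF p. 7)] -/
theorem kimThree_of_kim2025_OPEN_of_integral_of_periodTransfer
    (hK25s : Kim2025.thm11_kimShaLength_of_integralPeriod_OPEN)
    (hint : ∀ (W : WeierstrassCurve ℚ) [W.IsElliptic] [W.IsGloballyMinimal]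
      {N : ℕ} [NeZero N] (D : ModularParametrizationData W N), ¬ (3 : ℤ) ∣ D.maninConstant →
      ∀ r : ℚ, ratPlusSymbol D.f r ≠ 0 → 0 ≤ padicValRat 3 (ratPlusSymbol D.f r))
    (hper : ∀ (W : WeierstrassCurve ℚ) [W.IsElliptic] [W.IsGloballyMinimal]
      {N : ℕ} [NeZero N] (D : ModularParametrizationData W N), ¬ (3 : ℤ) ∣ D.maninConstant →
      ∃ u : ℚ, ‖(u : ℚ_[3])‖ = 1 ∧ W.realPeriodRat = u * plusPeriod D.f) :
    KimThree :=
  kimThree_of_kimThreeShaLength_of_periodTransfer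
    (kimThreeShaLength_of_kim2025_OPEN_of_integral hK25s hint) hper

/-- **[K25] PRIMARY `_OPEN` ∧ int ∧ per (additive rows only) ⟹ `X4SharpThreeKim`** (the N11
hypothesis of record). CONDITIONAL on the preprint. [claim: Kim2025RefinedTNC, status: under-review]
[cite: Kim2025RefinedTNC, Thm. 1.1 ("BSD"), Cor. 1.7 (ANNOUNCED preprint — the reason, not a source of truth)]
[cite: Kim2022StructureSelmer, §1.4.1 and §1.3.5 (PDF p. 7)] -/
theorem x4SharpThreeKim_of_kim2025_OPEN_of_integral_of_periodTransfer
    (hK25s : Kim2025.thm11_kimShaLength_of_integralPeriod_OPEN)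
    (hint : ∀ (W : WeierstrassCurve ℚ) [W.IsElliptic] [W.IsGloballyMinimal], Addv W 3 →
      ∀ {N : ℕ} [NeZero N] (D : ModularParametrizationData W N), ¬ (3 : ℤ) ∣ D.maninConstant →
      ∀ r : ℚ, ratPlusSymbol D.f r ≠ 0 → 0 ≤ padicValRat 3 (ratPlusSymbol D.f r))
    (hper : ∀ (W : WeierstrassCurve ℚ) [W.IsElliptic] [W.IsGloballyMinimal], Addv W 3 →
      ∀ {N : ℕ} [NeZero N] (D : ModularParametrizationData W N), ¬ (3 : ℤ) ∣ D.maninConstant →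
      ∃ u : ℚ, ‖(u : ℚ_[3])‖ = 1 ∧ W.realPeriodRat = u * plusPeriod D.f) :
    X4SharpThreeKim :=
  x4SharpThreeKim_of_x4SharpThreeKimShaLength_of_periodTransfer
    (x4SharpThreeKimShaLength_of_kim2025_OPEN_of_integral hK25s hint) hper

end ClassLevel

end Summit.BirchSwinnertonDyer.Rank1Residual.Additive

end
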